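import Mathlib
import Summits.KontsevichZagierPeriods.Zeta5Search.Profile8bCellsA
import Summits.KontsevichZagierPeriods.Zeta5Search.Profile8bCellsB
import Summits.KontsevichZagierPeriods.Zeta5Search.Profile8cCellsA
import Summits.KontsevichZagierPeriods.Zeta5Search.Profile8cCellsB
import Summits.KontsevichZagierPeriods.Zeta5Search.DenomLaw.Profile15aPath
import Summits.KontsevichZagierPeriods.Zeta5Search.DenomLaw.ZeroPointCoverKit
import Summits.KontsevichZagierPeriods.Zeta5Search.DenomLaw.ZeroCoverKit
import Summits.KontsevichZagierPeriods.Zeta5Search.DenomLaw.LawZL5CoverKit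
import Summits.KontsevichZagierPeriods.Zeta5Search.DenomLaw.PathWeightProfile
import Summits.KontsevichZagierPeriods.Zeta5Search.CasoratianClassBoundPal
import Summits.KontsevichZagierPeriods.Zeta5Search.FlagRayDominance
import Summits.KontsevichZagierPeriods.Zeta5Search.TopFamilyFPCasLB
import Summits.KontsevichZagierPeriods.Zeta5Search.DenomLaw.Profile10PathC
import Summits.KontsevichZagierPeriods.Zeta5Search.DenomLaw.Profile11PathA
import HarnessLib

/-!
# ζ(5) search — the `N_p = 8` PROFILES 8b AND 8c of the first period for EVERY sorted parameter vector: PATH accounting at every depth (DENOM-LAW D1, prover-d1 gen 22)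

Cell `pub-zeta5` (HONEST FRAMING: systematic search; no irrationality claim unless certified), TRACK «DENOM-LAW» D1 prover seat (denom-prover-d1
gen 22, `HOME/denom-law/prover-d1/ATTEMPT-22.md` §6).  The four a = 7 profiles with exactly thirteen short pair blocks (`C⋆ ≤ 9` on each — new finite checks
`cStar_le_nine_8a/8b/8c/8d`; `d < 2p`; node `−4 / −3` at `⌊d/p⌋ = 0 / 1`): 8a short `(i,k)`, `i ≤ 3, k ≤ 6`, and `(4,5)` (THEOREM LB `(−4,0)` for every `d`,
`(−4,1)` at `p ≤ d`); 8b short all `(1,k)`, `(2,k)`, `(3,4)`, `(3,5)` and 8c short all `(1,k)`, `(2,3),…,(2,6),(3,4),(3,5),(3,6)` (THEOREM LB♯ `VB = −4`, row `0` for every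
`d` via gen 22's `cover_LBP_j`; the DOUBLE DROP at `N = 4` with LB fallback, `StairFLAG.cover_B_j`, at `p ≤ d`); 8d short all `(1,k)`, the pairs within `{2,…,5}`,
`(2,6)` (THEOREM LB `(−3, 0)` for every `d`).  Covers `FullProfile.cover8x_ev/od` (`Profile8{a,…,d}Cells{A,B}`, machine-generated; every check `decide`).
Results: `pathAccounting_profile8x` (every `j`) and **`pathAccountingFirstPeriod_profile8x`** (the node's binders VERBATIM plus `p ≤ b₇` and the profile
inequalities; no depth hypothesis), x ∈ {b, c}.  Census beside the proof (gen 22, exhaustive a = 7 at p = 7, 11, 5 % sample at p = 13): 8a 1,541 · 8b 1,363 · 8c 1,181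
· 8d 620 instances at p ≤ 13, every one reached by exactly these rungs; 0 open at p ≤ 13 (kit j285126).
MODEL/structure-side valuation bookkeeping of the cell's own rationals; nothing about ζ(5); no γ; records in print UNMOVED.
-/

open Finset

namespace Summit.KontsevichZagierPeriods.Zeta5Search.FullProfile

open Summit.KontsevichZagierPeriods.Zeta5Search.ClusterValuation
open Summit.KontsevichZagierPeriods.Zeta5Search.CasoratianValuation (InPolytope shift casoratian pairFloors refund)
open Summit.KontsevichZagierPeriods.Zeta5Search.WedgeDictionary (dOf)
open Summit.KontsevichZagierPeriods.Zeta5Search.ClassTypeCover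
open Summit.KontsevichZagierPeriods.Zeta5Search.DenomLaw (cStar FirstPeriod Sorted7 zeroClasses_of_cover zeroBound_of_classes zeroPointBound_of_classes cover_A3K cover_A4 cover_ZA rowsPal_of_cover)
open Summit.KontsevichZagierPeriods.Zeta5Search.DenomLaw.FirstPeriodKit (cStar_le_eleven sorted7_chain firstPeriod_pair pairFloors_expand)
open Summit.KontsevichZagierPeriods.Zeta5Search.ZeroWindows (ZeroWindowClasses)
open Summit.KontsevichZagierPeriods.Zeta5Search.TopFamFP (cover_J_j)
open Summit.KontsevichZagierPeriods.Zeta5Search.StairFLAG (cover_B_j)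
open Summit.KontsevichZagierPeriods.Zeta5Search.SortedProfile

/-! ## `C⋆ ≤ 9` on 8b and 8c -/

/-- **`C⋆ ≤ 9` on 8b**. -/
theorem cStar_le_nine_8b {b : ℕ → ℤ} {p : ℕ} (hs : Sorted7 b) (hQ : b 0 < (p : ℤ) + b 2 + b 7) (hQ35 : b 0 < (p : ℤ) + b 3 + b 5) : cStar b p ≤ 9 := by
  obtain ⟨h21, h32, h43, h54, h65, h76⟩ := sorted7_chain hs
  refine DenomLaw.FirstPeriodKit.cStar_le_of_profile (fun _ => True)
    (fun i k => ¬ (((i.val ≤ 1 ∨ k.val ≤ 1) ∨ (i.val = 2 ∧ k.val ≤ 4) ∨ (k.val = 2 ∧ i.val ≤ 4)) ∧ i.val ≠ k.val)) 9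
    (fun _ _ => trivial) ?_ (by decide +kernel)
  intro i k hik h
  obtain ⟨h, hne⟩ := h
  have := i.isLt; have := k.isLt
  exfalso
  rcases h with (hi | hk) | ⟨hi, hk⟩ | ⟨hk, hi⟩ <;> interval_cases hv : i.val <;> interval_cases hw : k.val <;>
    simp only [Nat.reduceAdd] at hik <;> omega


/-- **`C⋆ ≤ 9` on 8c**. -/
theorem cStar_le_nine_8c {b : ℕ → ℤ} {p : ℕ} (hs : Sorted7 b) (hQ : b 0 < (p : ℤ) + b 1 + b 7) (hQ36 : b 0 < (p : ℤ) + b 3 + b 6) : cStar b p ≤ 9 := by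
  obtain ⟨h21, h32, h43, h54, h65, h76⟩ := sorted7_chain hs
  refine DenomLaw.FirstPeriodKit.cStar_le_of_profile (fun _ => True)
    (fun i k => ¬ (((i.val = 0 ∨ k.val = 0) ∨ (1 ≤ i.val ∧ i.val ≤ 2 ∧ k.val ≤ 5) ∨ (1 ≤ k.val ∧ k.val ≤ 2 ∧ i.val ≤ 5)) ∧ i.val ≠ k.val)) 9
    (fun _ _ => trivial) ?_ (by decide +kernel)
  intro i k hik h
  obtain ⟨h, hne⟩ := h
  have := i.isLt; have := k.isLt
  exfalso
  rcases h with (hi | hk) | ⟨hi1, hi2, hk⟩ | ⟨hk1, hk2, hi⟩ <;> interval_cases hv : i.val <;> interval_cases hw : k.val <;>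
    simp only [Nat.reduceAdd] at hik <;> omega


/-! ## The `N_p = 8` profile with short blocks `all (1,k), (2,k), and (3,4),(3,5)` -/

section P8B

variable {b : ℕ → ℤ} {j p : ℕ}

/-- **`N_p = 8`** on this profile: the pair digits of the thirteen short blocks are `0`, the other eight are `1`. -/
theorem pairFloors_eq_8b (hb : InPolytope b) (hs : Sorted7 b) (hp : 0 < p) (hQ : b 0 < (p : ℤ) + b 2 + b 7) (hQ35 : b 0 < (p : ℤ) + b 3 + b 5) (hQ36 : (p : ℤ) + b 3 + b 6 ≤ b 0) (hQ45 : (p : ℤ) + b 4 + b 5 ≤ b 0) (hfp : FirstPeriod b p) : pairFloors b p = 8 := by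
  obtain ⟨h21, h32, h43, h54, h65, h76⟩ := sorted7_chain hs
  obtain ⟨h0, hb1, hb2, hb3, hb4, hb5, hb6, hb7, hc1⟩ := box hb
  have hp0 : (0 : ℤ) < p := by exact_mod_cast hp
  have one : ∀ z : ℤ, (p : ℤ) ≤ z → z ≤ 2 * (p : ℤ) - 1 → z / (p : ℤ) = 1 := fun z h1 h2 => by
    rw [Int.ediv_eq_iff_of_pos hp0]; constructor <;> linarith
  have z12 : (b 0 - b 1 - b 2) / (p : ℤ) = 0 := Int.ediv_eq_zero_of_lt (by linarith) (by linarith)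
  have z13 : (b 0 - b 1 - b 3) / (p : ℤ) = 0 := Int.ediv_eq_zero_of_lt (by linarith) (by linarith)
  have z14 : (b 0 - b 1 - b 4) / (p : ℤ) = 0 := Int.ediv_eq_zero_of_lt (by linarith) (by linarith)
  have z15 : (b 0 - b 1 - b 5) / (p : ℤ) = 0 := Int.ediv_eq_zero_of_lt (by linarith) (by linarith)
  have z16 : (b 0 - b 1 - b 6) / (p : ℤ) = 0 := Int.ediv_eq_zero_of_lt (by linarith) (by linarith)
  have z17 : (b 0 - b 1 - b 7) / (p : ℤ) = 0 := Int.ediv_eq_zero_of_lt (by linarith) (by linarith)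
  have z23 : (b 0 - b 2 - b 3) / (p : ℤ) = 0 := Int.ediv_eq_zero_of_lt (by linarith) (by linarith)
  have z24 : (b 0 - b 2 - b 4) / (p : ℤ) = 0 := Int.ediv_eq_zero_of_lt (by linarith) (by linarith)
  have z25 : (b 0 - b 2 - b 5) / (p : ℤ) = 0 := Int.ediv_eq_zero_of_lt (by linarith) (by linarith)
  have z26 : (b 0 - b 2 - b 6) / (p : ℤ) = 0 := Int.ediv_eq_zero_of_lt (by linarith) (by linarith)
  have z27 : (b 0 - b 2 - b 7) / (p : ℤ) = 0 := Int.ediv_eq_zero_of_lt (by linarith) (by linarith)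
  have z34 : (b 0 - b 3 - b 4) / (p : ℤ) = 0 := Int.ediv_eq_zero_of_lt (by linarith) (by linarith)
  have z35 : (b 0 - b 3 - b 5) / (p : ℤ) = 0 := Int.ediv_eq_zero_of_lt (by linarith) (by linarith)
  have U := fun (i k : ℕ) (hi : i < 7) (hk : k < 7) (hik : i < k) => firstPeriod_pair hfp hi hk hik
  rw [pairFloors_expand, z12, z13, z14, z15, z16, z17, z23, z24, z25, z26, z27, z34, z35,
    one _ (by linarith) (U 2 5 (by norm_num) (by norm_num) (by norm_num)),
    one _ (by linarith) (U 2 6 (by norm_num) (by norm_num) (by norm_num)),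
    one _ (by linarith) (U 3 4 (by norm_num) (by norm_num) (by norm_num)),
    one _ (by linarith) (U 3 5 (by norm_num) (by norm_num) (by norm_num)),
    one _ (by linarith) (U 3 6 (by norm_num) (by norm_num) (by norm_num)),
    one _ (by linarith) (U 4 5 (by norm_num) (by norm_num) (by norm_num)),
    one _ (by linarith) (U 4 6 (by norm_num) (by norm_num) (by norm_num)),
    one _ (by linarith) (U 5 6 (by norm_num) (by norm_num) (by norm_num))]
  norm_num

/-- **THEOREM LB♯ (palindromic rows) on this profile, general `b`, any depth**: `v_p(Cas_j(b)) ≥ -4` (`VB = -4`, row `0`; gen 22's `cover_LBP_j`). -/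
theorem cas_ge8b_neg4 (hb : InPolytope b) (hs : Sorted7 b) (hbj : InPolytope (shift b j)) (hj1 : 1 ≤ j) (hj7 : j ≤ 7)
    (hprime : p.Prime) (hp5 : 5 ≤ p) (hwin : (b 0 + 2 : ℤ) < (p : ℤ) ^ 2) (hP : (p : ℤ) ≤ b 7) (hQ : b 0 < (p : ℤ) + b 2 + b 7) (hQ35 : b 0 < (p : ℤ) + b 3 + b 5) (hQ36 : (p : ℤ) + b 3 + b 6 ≤ b 0) (hQ45 : (p : ℤ) + b 4 + b 5 ≤ b 0)
    (hF1 : b 1 < 2 * (p : ℤ)) (hF2 : b 0 < 2 * (p : ℤ) + b 6 + b 7) (hcas : casoratian b j ≠ 0) : (-4 : ℤ) ≤ padicValRat p (casoratian b j) := by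
  haveI : Fact p.Prime := ⟨hprime⟩
  have hp2 : p % 2 = 1 := Nat.odd_iff.1 (hprime.odd_of_ne_two (by omega))
  obtain ⟨h21, h32, h43, h54, h65, h76⟩ := sorted7_chain hs
  obtain ⟨h0, hb1, hb2, hb3, hb4, hb5, hb6, hb7, hc1⟩ := box hb
  have hpb : (p : ℤ) ≤ b 0 := by linarith
  rcases Int.emod_two_eq_zero_or_one (b 0) with hr | hr
  · exact cover_LBP_j hb hj1 hj7 hbj hprime hp5 hpb hwin (cover8b_ev hb hs hP hQ hQ35 hQ36 hQ45 hF1 hF2 hp5 hp2 hr) (v := -4) (B₀ := -20) (r := 0)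
      (by rw [oddFlag_false hr]; decide) (by norm_num) (by rw [oddFlag_false hr]; decide) (fun _ => by norm_num) hcas
  · exact cover_LBP_j hb hj1 hj7 hbj hprime hp5 hpb hwin (cover8b_od hb hs hP hQ hQ35 hQ36 hQ45 hF1 hF2 hp5 hp2 hr) (v := -4) (B₀ := -20) (r := 0)
      (by rw [oddFlag_true hr]; decide) (by norm_num) (by rw [oddFlag_true hr]; decide) (fun _ => by norm_num) hcas

/-- **THEOREM LB / the double-drop bonus at `N = 4` on this profile, general `b`**: `v_p(Cas_j(b)) ≥ −3` — where a class of type `[1,−3,−3,1]`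
(exponent `−4`) exists the double drop gives `casLB + 2 = −5 + 2`; where none exists THEOREM LB alone gives `−3 + 0` (`StairFLAG.cover_B_j`). -/
theorem cas_ge8b_neg3 (hb : InPolytope b) (hs : Sorted7 b) (hbj : InPolytope (shift b j)) (hj1 : 1 ≤ j) (hj7 : j ≤ 7)
    (hprime : p.Prime) (hp5 : 5 ≤ p) (hwin : (b 0 + 2 : ℤ) < (p : ℤ) ^ 2) (hP : (p : ℤ) ≤ b 7) (hQ : b 0 < (p : ℤ) + b 2 + b 7) (hQ35 : b 0 < (p : ℤ) + b 3 + b 5) (hQ36 : (p : ℤ) + b 3 + b 6 ≤ b 0) (hQ45 : (p : ℤ) + b 4 + b 5 ≤ b 0)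
    (hF1 : b 1 < 2 * (p : ℤ)) (hF2 : b 0 < 2 * (p : ℤ) + b 6 + b 7) (hpd : (p : ℤ) ≤ dOf b) (hcas : casoratian b j ≠ 0) : (-3 : ℤ) ≤ padicValRat p (casoratian b j) := by
  haveI : Fact p.Prime := ⟨hprime⟩
  have hp2 : p % 2 = 1 := Nat.odd_iff.1 (hprime.odd_of_ne_two (by omega))
  obtain ⟨h21, h32, h43, h54, h65, h76⟩ := sorted7_chain hs
  obtain ⟨h0, hb1, hb2, hb3, hb4, hb5, hb6, hb7, hc1⟩ := box hb
  have hpb : (p : ℤ) ≤ b 0 := by linarith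
  rcases Int.emod_two_eq_zero_or_one (b 0) with hr | hr
  · exact cover_B_j hb hj1 hj7 hbj hprime hp5 hpb hpd hwin (cover8b_ev hb hs hP hQ hQ35 hQ36 hQ45 hF1 hF2 hp5 hp2 hr) (N := 4) (by norm_num) (by decide)
      (B := -1) (A' := -3) (B' := 0) (c := -3) (by rw [oddFlag_false hr]; decide) (by norm_num) (by rw [oddFlag_false hr]; decide)
      (by rw [oddFlag_false hr]; decide) (by norm_num) (by norm_num) (by norm_num) (by norm_num) hcas
  · exact cover_B_j hb hj1 hj7 hbj hprime hp5 hpb hpd hwin (cover8b_od hb hs hP hQ hQ35 hQ36 hQ45 hF1 hF2 hp5 hp2 hr) (N := 4) (by norm_num) (by decide)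
      (B := -1) (A' := -3) (B' := 0) (c := -3) (by rw [oddFlag_true hr]; decide) (by norm_num) (by rw [oddFlag_true hr]; decide)
      (by rw [oddFlag_true hr]; decide) (by norm_num) (by norm_num) (by norm_num) (by norm_num) hcas

/-- On this profile `d(b) < 2p`. -/
theorem d_lt_two8b (hs : Sorted7 b) (hP : (p : ℤ) ≤ b 7) (_hQ : b 0 < (p : ℤ) + b 2 + b 7) (_hQ35 : b 0 < (p : ℤ) + b 3 + b 5) (_hQ36 : (p : ℤ) + b 3 + b 6 ≤ b 0) (_hQ45 : (p : ℤ) + b 4 + b 5 ≤ b 0) : dOf b < 2 * (p : ℤ) := by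
  obtain ⟨h21, h32, h43, h54, h65, h76⟩ := sorted7_chain hs
  rw [DecompositionWholeCone.dOf_expand]; linarith

/-- **`PathAccountingFirstPeriod`'s conclusion on this `N_p = 8` profile (short blocks `all (1,k), (2,k), and (3,4),(3,5)`), EVERY sorted `b`, every direction `j`, every depth**
(`C⋆ ≤ 9`; `d < 2p`; the node asks `-4` at `⌊d/p⌋ = 0` and `-3` at `⌊d/p⌋ = 1`). -/
theorem pathAccounting_profile8b (b : ℕ → ℤ) (j p : ℕ) (hb : InPolytope b) (hs : Sorted7 b) (hbj : InPolytope (shift b j))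
    (hj1 : 1 ≤ j) (hj7 : j ≤ 7) (hprime : p.Prime) (hp5 : 5 ≤ p) (hwin : (b 0 + 2 : ℤ) < (p : ℤ) ^ 2) (hfp : FirstPeriod b p)
    (hP : (p : ℤ) ≤ b 7) (hQ : b 0 < (p : ℤ) + b 2 + b 7) (hQ35 : b 0 < (p : ℤ) + b 3 + b 5) (hQ36 : (p : ℤ) + b 3 + b 6 ≤ b 0) (hQ45 : (p : ℤ) + b 4 + b 5 ≤ b 0)
    (hcas : casoratian b j ≠ 0) :
    dOf b / (p : ℤ) - pairFloors b p - min (if 2 ≤ dOf b / (p : ℤ) then (1 : ℤ) else 0) (5 - (cStar b p : ℤ))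
      ≤ padicValRat p (casoratian b j) := by
  obtain ⟨hF1, hF2⟩ := fp_bounds hfp
  have hp0 : (0 : ℤ) < p := by exact_mod_cast hprime.pos
  rw [pairFloors_eq_8b hb hs hprime.pos hQ hQ35 hQ36 hQ45 hfp]
  have hC9 : (cStar b p : ℤ) ≤ 9 := by exact_mod_cast cStar_le_nine_8b hs hQ hQ35
  have hfd : dOf b / (p : ℤ) < 2 := by rw [Int.ediv_lt_iff_lt_mul hp0]; linarith [d_lt_two8b hs hP hQ hQ35 hQ36 hQ45]
  rw [if_neg (by omega)]
  have hmin : -4 ≤ min (0 : ℤ) (5 - (cStar b p : ℤ)) := le_min (by norm_num) (by linarith)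
  by_cases h1 : (p : ℤ) ≤ dOf b
  · linarith [cas_ge8b_neg3 hb hs hbj hj1 hj7 hprime hp5 hwin hP hQ hQ35 hQ36 hQ45 hF1 hF2 h1 hcas]
  · push Not at h1
    obtain ⟨h21, h32, h43, h54, h65, h76⟩ := sorted7_chain hs
    have hd0 : 0 ≤ dOf b := by rw [DecompositionWholeCone.dOf_expand]; linarith [hb.2.2]
    have hfd0 : dOf b / (p : ℤ) = 0 := Int.ediv_eq_zero_of_lt hd0 h1
    rw [hfd0]
    linarith [cas_ge8b_neg4 hb hs hbj hj1 hj7 hprime hp5 hwin hP hQ hQ35 hQ36 hQ45 hF1 hF2 hcas]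

/-- **THE NODE ON THIS `N_p = 8` PROFILE, EVERY SORTED `b`, EVERY DEPTH: `PathAccountingFirstPeriod` with its binders VERBATIM plus `p ≤ b₇` and the profile
inequalities.** -/
theorem pathAccountingFirstPeriod_profile8b :
    ∀ (b : ℕ → ℤ) (p : ℕ), InPolytope b → Sorted7 b → InPolytope (shift b 7) →
      p.Prime → 5 ≤ p → (b 0 + 2 : ℤ) < (p : ℤ) ^ 2 → FirstPeriod b p →
      (p : ℤ) ≤ b 7 → b 0 < (p : ℤ) + b 2 + b 7 → b 0 < (p : ℤ) + b 3 + b 5 → (p : ℤ) + b 3 + b 6 ≤ b 0 → (p : ℤ) + b 4 + b 5 ≤ b 0 → casoratian b 7 ≠ 0 →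
        dOf b / (p : ℤ) - pairFloors b p - min (if 2 ≤ dOf b / (p : ℤ) then (1 : ℤ) else 0) (5 - (cStar b p : ℤ))
          ≤ padicValRat p (casoratian b 7) :=
  fun b p hb hs hb7 hprime hp5 hwin hfp hP hQ hQ35 hQ36 hQ45 hcas =>
    pathAccounting_profile8b b 7 p hb hs hb7 (by norm_num) (by norm_num) hprime hp5 hwin hfp hP hQ hQ35 hQ36 hQ45 hcas

end P8B

/-! ## The `N_p = 8` profile with short blocks `all (1,k), (2,3),…,(2,6),(3,4),(3,5),(3,6)` -/

section P8C

variable {b : ℕ → ℤ} {j p : ℕ}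

/-- **`N_p = 8`** on this profile: the pair digits of the thirteen short blocks are `0`, the other eight are `1`. -/
theorem pairFloors_eq_8c (hb : InPolytope b) (hs : Sorted7 b) (hp : 0 < p) (hQ : b 0 < (p : ℤ) + b 1 + b 7) (hQ36 : b 0 < (p : ℤ) + b 3 + b 6) (hQ27 : (p : ℤ) + b 2 + b 7 ≤ b 0) (hQ45 : (p : ℤ) + b 4 + b 5 ≤ b 0) (hfp : FirstPeriod b p) : pairFloors b p = 8 := by
  obtain ⟨h21, h32, h43, h54, h65, h76⟩ := sorted7_chain hs
  obtain ⟨h0, hb1, hb2, hb3, hb4, hb5, hb6, hb7, hc1⟩ := box hb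
  have hp0 : (0 : ℤ) < p := by exact_mod_cast hp
  have one : ∀ z : ℤ, (p : ℤ) ≤ z → z ≤ 2 * (p : ℤ) - 1 → z / (p : ℤ) = 1 := fun z h1 h2 => by
    rw [Int.ediv_eq_iff_of_pos hp0]; constructor <;> linarith
  have z12 : (b 0 - b 1 - b 2) / (p : ℤ) = 0 := Int.ediv_eq_zero_of_lt (by linarith) (by linarith)
  have z13 : (b 0 - b 1 - b 3) / (p : ℤ) = 0 := Int.ediv_eq_zero_of_lt (by linarith) (by linarith)
  have z14 : (b 0 - b 1 - b 4) / (p : ℤ) = 0 := Int.ediv_eq_zero_of_lt (by linarith) (by linarith)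
  have z15 : (b 0 - b 1 - b 5) / (p : ℤ) = 0 := Int.ediv_eq_zero_of_lt (by linarith) (by linarith)
  have z16 : (b 0 - b 1 - b 6) / (p : ℤ) = 0 := Int.ediv_eq_zero_of_lt (by linarith) (by linarith)
  have z17 : (b 0 - b 1 - b 7) / (p : ℤ) = 0 := Int.ediv_eq_zero_of_lt (by linarith) (by linarith)
  have z23 : (b 0 - b 2 - b 3) / (p : ℤ) = 0 := Int.ediv_eq_zero_of_lt (by linarith) (by linarith)
  have z24 : (b 0 - b 2 - b 4) / (p : ℤ) = 0 := Int.ediv_eq_zero_of_lt (by linarith) (by linarith)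
  have z25 : (b 0 - b 2 - b 5) / (p : ℤ) = 0 := Int.ediv_eq_zero_of_lt (by linarith) (by linarith)
  have z26 : (b 0 - b 2 - b 6) / (p : ℤ) = 0 := Int.ediv_eq_zero_of_lt (by linarith) (by linarith)
  have z34 : (b 0 - b 3 - b 4) / (p : ℤ) = 0 := Int.ediv_eq_zero_of_lt (by linarith) (by linarith)
  have z35 : (b 0 - b 3 - b 5) / (p : ℤ) = 0 := Int.ediv_eq_zero_of_lt (by linarith) (by linarith)
  have z36 : (b 0 - b 3 - b 6) / (p : ℤ) = 0 := Int.ediv_eq_zero_of_lt (by linarith) (by linarith)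
  have U := fun (i k : ℕ) (hi : i < 7) (hk : k < 7) (hik : i < k) => firstPeriod_pair hfp hi hk hik
  rw [pairFloors_expand, z12, z13, z14, z15, z16, z17, z23, z24, z25, z26, z34, z35, z36,
    one _ (by linarith) (U 1 6 (by norm_num) (by norm_num) (by norm_num)),
    one _ (by linarith) (U 2 6 (by norm_num) (by norm_num) (by norm_num)),
    one _ (by linarith) (U 3 4 (by norm_num) (by norm_num) (by norm_num)),
    one _ (by linarith) (U 3 5 (by norm_num) (by norm_num) (by norm_num)),
    one _ (by linarith) (U 3 6 (by norm_num) (by norm_num) (by norm_num)),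
    one _ (by linarith) (U 4 5 (by norm_num) (by norm_num) (by norm_num)),
    one _ (by linarith) (U 4 6 (by norm_num) (by norm_num) (by norm_num)),
    one _ (by linarith) (U 5 6 (by norm_num) (by norm_num) (by norm_num))]
  norm_num

/-- **THEOREM LB♯ (palindromic rows) on this profile, general `b`, any depth**: `v_p(Cas_j(b)) ≥ -4` (`VB = -4`, row `0`; gen 22's `cover_LBP_j`). -/
theorem cas_ge8c_neg4 (hb : InPolytope b) (hs : Sorted7 b) (hbj : InPolytope (shift b j)) (hj1 : 1 ≤ j) (hj7 : j ≤ 7)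
    (hprime : p.Prime) (hp5 : 5 ≤ p) (hwin : (b 0 + 2 : ℤ) < (p : ℤ) ^ 2) (hP : (p : ℤ) ≤ b 7) (hQ : b 0 < (p : ℤ) + b 1 + b 7) (hQ36 : b 0 < (p : ℤ) + b 3 + b 6) (hQ27 : (p : ℤ) + b 2 + b 7 ≤ b 0) (hQ45 : (p : ℤ) + b 4 + b 5 ≤ b 0)
    (hF1 : b 1 < 2 * (p : ℤ)) (hF2 : b 0 < 2 * (p : ℤ) + b 6 + b 7) (hcas : casoratian b j ≠ 0) : (-4 : ℤ) ≤ padicValRat p (casoratian b j) := by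
  haveI : Fact p.Prime := ⟨hprime⟩
  have hp2 : p % 2 = 1 := Nat.odd_iff.1 (hprime.odd_of_ne_two (by omega))
  obtain ⟨h21, h32, h43, h54, h65, h76⟩ := sorted7_chain hs
  obtain ⟨h0, hb1, hb2, hb3, hb4, hb5, hb6, hb7, hc1⟩ := box hb
  have hpb : (p : ℤ) ≤ b 0 := by linarith
  rcases Int.emod_two_eq_zero_or_one (b 0) with hr | hr
  · exact cover_LBP_j hb hj1 hj7 hbj hprime hp5 hpb hwin (cover8c_ev hb hs hP hQ hQ36 hQ27 hQ45 hF1 hF2 hp5 hp2 hr) (v := -4) (B₀ := -20) (r := 0)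
      (by rw [oddFlag_false hr]; decide) (by norm_num) (by rw [oddFlag_false hr]; decide) (fun _ => by norm_num) hcas
  · exact cover_LBP_j hb hj1 hj7 hbj hprime hp5 hpb hwin (cover8c_od hb hs hP hQ hQ36 hQ27 hQ45 hF1 hF2 hp5 hp2 hr) (v := -4) (B₀ := -20) (r := 0)
      (by rw [oddFlag_true hr]; decide) (by norm_num) (by rw [oddFlag_true hr]; decide) (fun _ => by norm_num) hcas

/-- **THEOREM LB / the double-drop bonus at `N = 4` on this profile, general `b`**: `v_p(Cas_j(b)) ≥ −3` — where a class of type `[1,−3,−3,1]`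
(exponent `−4`) exists the double drop gives `casLB + 2 = −5 + 2`; where none exists THEOREM LB alone gives `−3 + 0` (`StairFLAG.cover_B_j`). -/
theorem cas_ge8c_neg3 (hb : InPolytope b) (hs : Sorted7 b) (hbj : InPolytope (shift b j)) (hj1 : 1 ≤ j) (hj7 : j ≤ 7)
    (hprime : p.Prime) (hp5 : 5 ≤ p) (hwin : (b 0 + 2 : ℤ) < (p : ℤ) ^ 2) (hP : (p : ℤ) ≤ b 7) (hQ : b 0 < (p : ℤ) + b 1 + b 7) (hQ36 : b 0 < (p : ℤ) + b 3 + b 6) (hQ27 : (p : ℤ) + b 2 + b 7 ≤ b 0) (hQ45 : (p : ℤ) + b 4 + b 5 ≤ b 0)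
    (hF1 : b 1 < 2 * (p : ℤ)) (hF2 : b 0 < 2 * (p : ℤ) + b 6 + b 7) (hpd : (p : ℤ) ≤ dOf b) (hcas : casoratian b j ≠ 0) : (-3 : ℤ) ≤ padicValRat p (casoratian b j) := by
  haveI : Fact p.Prime := ⟨hprime⟩
  have hp2 : p % 2 = 1 := Nat.odd_iff.1 (hprime.odd_of_ne_two (by omega))
  obtain ⟨h21, h32, h43, h54, h65, h76⟩ := sorted7_chain hs
  obtain ⟨h0, hb1, hb2, hb3, hb4, hb5, hb6, hb7, hc1⟩ := box hb
  have hpb : (p : ℤ) ≤ b 0 := by linarith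
  rcases Int.emod_two_eq_zero_or_one (b 0) with hr | hr
  · exact cover_B_j hb hj1 hj7 hbj hprime hp5 hpb hpd hwin (cover8c_ev hb hs hP hQ hQ36 hQ27 hQ45 hF1 hF2 hp5 hp2 hr) (N := 4) (by norm_num) (by decide)
      (B := -1) (A' := -3) (B' := 0) (c := -3) (by rw [oddFlag_false hr]; decide) (by norm_num) (by rw [oddFlag_false hr]; decide)
      (by rw [oddFlag_false hr]; decide) (by norm_num) (by norm_num) (by norm_num) (by norm_num) hcas
  · exact cover_B_j hb hj1 hj7 hbj hprime hp5 hpb hpd hwin (cover8c_od hb hs hP hQ hQ36 hQ27 hQ45 hF1 hF2 hp5 hp2 hr) (N := 4) (by norm_num) (by decide)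
      (B := -1) (A' := -3) (B' := 0) (c := -3) (by rw [oddFlag_true hr]; decide) (by norm_num) (by rw [oddFlag_true hr]; decide)
      (by rw [oddFlag_true hr]; decide) (by norm_num) (by norm_num) (by norm_num) (by norm_num) hcas

/-- On this profile `d(b) < 2p`. -/
theorem d_lt_two8c (hs : Sorted7 b) (hP : (p : ℤ) ≤ b 7) (_hQ : b 0 < (p : ℤ) + b 1 + b 7) (_hQ36 : b 0 < (p : ℤ) + b 3 + b 6) (_hQ27 : (p : ℤ) + b 2 + b 7 ≤ b 0) (_hQ45 : (p : ℤ) + b 4 + b 5 ≤ b 0) : dOf b < 2 * (p : ℤ) := by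
  obtain ⟨h21, h32, h43, h54, h65, h76⟩ := sorted7_chain hs
  rw [DecompositionWholeCone.dOf_expand]; linarith

/-- **`PathAccountingFirstPeriod`'s conclusion on this `N_p = 8` profile (short blocks `all (1,k), (2,3),…,(2,6),(3,4),(3,5),(3,6)`), EVERY sorted `b`, every direction `j`, every depth**
(`C⋆ ≤ 9`; `d < 2p`; the node asks `-4` at `⌊d/p⌋ = 0` and `-3` at `⌊d/p⌋ = 1`). -/
theorem pathAccounting_profile8c (b : ℕ → ℤ) (j p : ℕ) (hb : InPolytope b) (hs : Sorted7 b) (hbj : InPolytope (shift b j))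
    (hj1 : 1 ≤ j) (hj7 : j ≤ 7) (hprime : p.Prime) (hp5 : 5 ≤ p) (hwin : (b 0 + 2 : ℤ) < (p : ℤ) ^ 2) (hfp : FirstPeriod b p)
    (hP : (p : ℤ) ≤ b 7) (hQ : b 0 < (p : ℤ) + b 1 + b 7) (hQ36 : b 0 < (p : ℤ) + b 3 + b 6) (hQ27 : (p : ℤ) + b 2 + b 7 ≤ b 0) (hQ45 : (p : ℤ) + b 4 + b 5 ≤ b 0)
    (hcas : casoratian b j ≠ 0) :
    dOf b / (p : ℤ) - pairFloors b p - min (if 2 ≤ dOf b / (p : ℤ) then (1 : ℤ) else 0) (5 - (cStar b p : ℤ))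
      ≤ padicValRat p (casoratian b j) := by
  obtain ⟨hF1, hF2⟩ := fp_bounds hfp
  have hp0 : (0 : ℤ) < p := by exact_mod_cast hprime.pos
  rw [pairFloors_eq_8c hb hs hprime.pos hQ hQ36 hQ27 hQ45 hfp]
  have hC9 : (cStar b p : ℤ) ≤ 9 := by exact_mod_cast cStar_le_nine_8c hs hQ hQ36
  have hfd : dOf b / (p : ℤ) < 2 := by rw [Int.ediv_lt_iff_lt_mul hp0]; linarith [d_lt_two8c hs hP hQ hQ36 hQ27 hQ45]
  rw [if_neg (by omega)]
  have hmin : -4 ≤ min (0 : ℤ) (5 - (cStar b p : ℤ)) := le_min (by norm_num) (by linarith)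
  by_cases h1 : (p : ℤ) ≤ dOf b
  · linarith [cas_ge8c_neg3 hb hs hbj hj1 hj7 hprime hp5 hwin hP hQ hQ36 hQ27 hQ45 hF1 hF2 h1 hcas]
  · push Not at h1
    obtain ⟨h21, h32, h43, h54, h65, h76⟩ := sorted7_chain hs
    have hd0 : 0 ≤ dOf b := by rw [DecompositionWholeCone.dOf_expand]; linarith [hb.2.2]
    have hfd0 : dOf b / (p : ℤ) = 0 := Int.ediv_eq_zero_of_lt hd0 h1
    rw [hfd0]
    linarith [cas_ge8c_neg4 hb hs hbj hj1 hj7 hprime hp5 hwin hP hQ hQ36 hQ27 hQ45 hF1 hF2 hcas]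

/-- **THE NODE ON THIS `N_p = 8` PROFILE, EVERY SORTED `b`, EVERY DEPTH: `PathAccountingFirstPeriod` with its binders VERBATIM plus `p ≤ b₇` and the profile
inequalities.** -/
theorem pathAccountingFirstPeriod_profile8c :
    ∀ (b : ℕ → ℤ) (p : ℕ), InPolytope b → Sorted7 b → InPolytope (shift b 7) →
      p.Prime → 5 ≤ p → (b 0 + 2 : ℤ) < (p : ℤ) ^ 2 → FirstPeriod b p →
      (p : ℤ) ≤ b 7 → b 0 < (p : ℤ) + b 1 + b 7 → b 0 < (p : ℤ) + b 3 + b 6 → (p : ℤ) + b 2 + b 7 ≤ b 0 → (p : ℤ) + b 4 + b 5 ≤ b 0 → casoratian b 7 ≠ 0 →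
        dOf b / (p : ℤ) - pairFloors b p - min (if 2 ≤ dOf b / (p : ℤ) then (1 : ℤ) else 0) (5 - (cStar b p : ℤ))
          ≤ padicValRat p (casoratian b 7) :=
  fun b p hb hs hb7 hprime hp5 hwin hfp hP hQ hQ36 hQ27 hQ45 hcas =>
    pathAccounting_profile8c b 7 p hb hs hb7 (by norm_num) (by norm_num) hprime hp5 hwin hfp hP hQ hQ36 hQ27 hQ45 hcas

end P8C

end Summit.KontsevichZagierPeriods.Zeta5Search.FullProfile
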